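import Summits.QuantumFields.BalabanUV.Beta.GAN24.CombTowerEndOfT2ev
import Summits.QuantumFields.BalabanUV.Beta.GAN24.CombSRowsOfSectors

/-!
# `BalabanUV.Beta.GAN24.CombTowerEndOfSectorsT2ev` — binder row G-an2-4 ∕ (CONV-C), TRANSFER-III: **THE G-an2-4 END AT ROW D1's LITERAL OF RECORD (III′) FOR an1's RECORD,
# READ THROUGH road-P2's FOUR SECTOR LETTERS AND THE EVEN MEMBER's TWO T₂ ROWS ONLY** — MY `CombTowerEndOfT2ev` §3 (the END ⟸ S-rows of `ScombOf` ∧ «T2Shape^{ev}» ∧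
# «T2Drift^{ev}», S′-rows by `CombSpureRowsOfSRows`, W-rows by `CombWrecEvenHalfRows`, K by `KSlotCombChart` ∕ `KSlotAssembly`) with its S-rows `(hS, hSall)` SUPPLIED by road-P2 g56's
# M.53 `CombSRowsOfSectors.exists_hS_hSall_ScombOf_of_sectors` from the uniform ∕ all-scales-Cauchy unit rows of the WILSON LINEAGE `combWilsonAt Lc Lc⁴` and of the BORN REMAINDER
# `combBornOf Lc (symTablesAn1S2 3 Lc cΛt) Lc⁴ (−Lc⁸∕2) cΛ` (M.50: `ScombOf = combWilsonAt + combBornOf`); the two S-radii merged to their `min` (`locStencil_mono'`)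
# (G-an2-4 CRUX TEAM (2), leaf prover `b2b-balaban-gan24-formalise-leaf-02`, gen 79; R-gan24p1-g46-1 (c): the K-discharged (III′) ENDs are this lineage's)

NOT IN PRINT; OUR BOOKKEEPING ([folklore] composition BY NAME, one `obtain` + two radius merges + one `exact` per theorem; 0 `def`, 0 cited fact, 0 `def … : Prop`, 0 sorry).
HONEST FRAMING (cell contract, verbatim): «discharging `BetaPertH` makes Bałaban's UV stability UNCONDITIONAL — a real constructive-QFT result; it is NOT the continuum
limit and NOT the Clay problem.»  HONEST DEPENDENCY (verbatim): «continuum YM on T⁴ ⇐ BetaPertH ∧ nine spine estimates (0/9 proved); BetaPertH ⇐ (D1) ∧ (D4) ∧ CAP+tail;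
G-an2-4 gates asym, D1 and NE2/3/4.»

WHAT (`d = 3`, `Lc` odd, `2 ≤ Lc`, every `SU(N)`, an1's record `symTablesAn1S2 3 Lc cΛt`, pins `cE = Lc⁴`, `cVH = −Lc⁸∕2`, `cE₂ = Lc⁸`, `Tc = (8N²)⁻¹ • wsym22 N`, every `cΛt cΛ cB`):
* **`exists_allScalesSeq_JsB12CombShSym_an1_of_sectors_T2ev`**: `∃ κ θ, 0 ≤ θ ∧ θ < 1 ∧ AllScalesSeq (j ↦ secondMoment (TbalOf Lc (JsB12CombShSym hLc N (symTablesAn1S2 3 Lc cΛt) cΛ cB) j) μ ν) κ θ`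
  ⟸ (S-W0) `hSl` ∧ (S-B0) `hSb` ∧ (S-Wd) `hSld` ∧ (S-Bd) `hSbd` ∧ «T2Shape^{ev}» `hT₂` ∧ «T2Drift^{ev}» `hT₂d` — NOTHING ELSE;
* **`d1Drift_JsB12CombShSym_an1_iff_lim_eq_of_sectors_T2ev`** ∕ **`d1Drift_JsB12CombShSym_an1_iff_cesaro_of_sectors_T2ev`** — row D1's two READINGS of the wall under the same six rows.
READING (zero weight): this is the (III′) END's bill of 2026-08-25 in two currencies only — road-P2's S-campaign letters (M.51–M.58 work toward (S-W0)(S-B0)(S-Wd)(S-Bd)) and the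
OWNER's T4 `CombT2ShapeEvenEnd` ∕ T5 `CombT2DriftEvenEnd` conclusions (the two T₂ rows, under `hb ∕ hZ ∕ hy ∕ hbd ∕ hcell ∕ hcelld`, priced by leaf-01 ∕ leaf-03).  Asserts NO value of
Bałaban's tables; discharges NO sector letter, NO T₂ row, NO value `lim β = stepBal` (row D1's); the (III′) campaign is NOT asked (an2 W-4); NEVER «G-an2-4 closed» as (CONV-C);
NOT D1, NOT `BetaPertH`, NOT continuum, NOT Clay.  2026-08-25; no existing file touched.
-/

noncomputable section

open Literature.MathematicalPhysics.QuantumFieldTheory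
open Literature.MathematicalPhysics.QuantumFieldTheory.Balaban1983to89
open Literature.MathematicalPhysics.QuantumFieldTheory.Balaban1983to89.Beta
open Filter Topology
open scoped BigOperators
open RemainderConstAllScales (AllScalesSeq)
open OneStepResolventKernel (Fib LocStencil)
open OneStepKernelFamily (TbalOf D1Drift)
open BalabanCompositeJets (LocStencil₂)
open WilsonVertex2Sym (wsym22)
open Summit.QuantumFields.BalabanUV.Beta.TameKernelCalculus (trK)
open Summit.QuantumFields.BalabanUV.Beta.BorderedHessian (sgnK)
open Summit.QuantumFields.BalabanUV.Beta.HessKerDressedUnits (unitS)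
open Summit.QuantumFields.BalabanUV.Beta.SecondOrderUnits (unitS₂)
open Summit.QuantumFields.BalabanUV.Beta.SpineRooted (T2RecOf)
open Summit.QuantumFields.BalabanUV.Beta.CombChartStepJets (GcombSh ScombOf SpureCombOf)
open Summit.QuantumFields.BalabanUV.Beta.CombChartJointEnd (JsB12CombShSym)
open Summit.QuantumFields.BalabanUV.Beta.SymSecondOrderTablesAn1 (symTablesAn1S2)
open Summit.QuantumFields.BalabanUV.Beta.GAN24.CombesThomas (sfStep smStep)
open Summit.QuantumFields.BalabanUV.Beta.GAN24.StencilSlotOfShapes (locStencil_mono')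
open Summit.QuantumFields.BalabanUV.Beta.GAN24.CombWilsonSector (combWilsonAt combBornOf)
open Summit.QuantumFields.BalabanUV.Beta.GAN24.CombSRowsOfSectors (exists_hS_hSall_ScombOf_of_sectors)
open Summit.QuantumFields.BalabanUV.Beta.GAN24.CombTowerEndOfT2ev (exists_allScalesSeq_JsB12CombShSym_an1_of_sRows_T2ev
  d1Drift_JsB12CombShSym_an1_iff_lim_eq_of_sRows_T2ev d1Drift_JsB12CombShSym_an1_iff_cesaro_of_sRows_T2ev)

namespace Summit.QuantumFields.BalabanUV.Beta.GAN24.CombTowerEndOfSectorsT2ev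

variable {Lc : ℕ} [NeZero Lc] {C₂ c₂ δ₂ θ₂ : ℝ} (cΛt : ℝ)

/-- [our object; folklore composition] **THE G-an2-4 END AT (III′) FOR an1's RECORD ⟸ FOUR SECTOR LETTERS AND TWO T₂ ROWS ONLY** (`Lc` odd, `2 ≤ Lc`): `CombTowerEndOfT2ev`'s
`exists_allScalesSeq_JsB12CombShSym_an1_of_sRows_T2ev` with `(hS, hSall)` on `unitS_j (ScombOf (symTablesAn1S2 3 Lc cΛt) Lc⁴ (−Lc⁸∕2) cΛ j)` supplied by road-P2's
`exists_hS_hSall_ScombOf_of_sectors` from (S-W0)(S-B0)(S-Wd)(S-Bd); the two S-radii merged to `min δ₁ δ₂`. -/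
theorem exists_allScalesSeq_JsB12CombShSym_an1_of_sectors_T2ev (hLc : Odd Lc) (hLc2 : 2 ≤ Lc) (N : ℕ) (cΛ cB : ℝ)
    (hSl : ∃ Cl δl : ℝ, 0 < δl ∧ ∀ j : ℕ, LocStencil (unitS (sfStep Lc j) (smStep 3 Lc j) (combWilsonAt (d := 3) Lc ((Lc : ℝ) ^ 4) j)) Cl δl)
    (hSb : ∃ Cb δb : ℝ, 0 < δb ∧ ∀ j : ℕ,
      LocStencil (unitS (sfStep Lc j) (smStep 3 Lc j) (combBornOf Lc (symTablesAn1S2 3 Lc cΛt) ((Lc : ℝ) ^ 4) (-((Lc : ℝ) ^ 8 / 2)) cΛ j)) Cb δb)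
    (hSld : ∃ cl θl δl : ℝ, 0 ≤ cl ∧ 0 ≤ θl ∧ θl < 1 ∧ 0 < δl ∧ ∀ k j : ℕ,
      LocStencil (unitS (sfStep Lc (k + j)) (smStep 3 Lc (k + j)) (combWilsonAt (d := 3) Lc ((Lc : ℝ) ^ 4) (k + j))
        - unitS (sfStep Lc k) (smStep 3 Lc k) (combWilsonAt (d := 3) Lc ((Lc : ℝ) ^ 4) k)) (cl * θl ^ k) δl)
    (hSbd : ∃ cb θb δb : ℝ, 0 ≤ cb ∧ 0 ≤ θb ∧ θb < 1 ∧ 0 < δb ∧ ∀ k j : ℕ,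
      LocStencil (unitS (sfStep Lc (k + j)) (smStep 3 Lc (k + j)) (combBornOf Lc (symTablesAn1S2 3 Lc cΛt) ((Lc : ℝ) ^ 4) (-((Lc : ℝ) ^ 8 / 2)) cΛ (k + j))
        - unitS (sfStep Lc k) (smStep 3 Lc k) (combBornOf Lc (symTablesAn1S2 3 Lc cΛt) ((Lc : ℝ) ^ 4) (-((Lc : ℝ) ^ 8 / 2)) cΛ k)) (cb * θb ^ k) δb)
    (hT₂ : ∀ j, LocStencil₂ (((1 : ℝ) / 2) • (unitS₂ (sfStep Lc j) (smStep 3 Lc j)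
        (T2RecOf 3 Lc (GcombSh Lc) (SpureCombOf (symTablesAn1S2 3 Lc cΛt) ((Lc : ℝ) ^ 4) (-((Lc : ℝ) ^ 8 / 2)) cΛ) (symTablesAn1S2 3 Lc cΛt).M ((Lc : ℝ) ^ 8) cB
          ((8 * (N : ℝ) ^ 2)⁻¹ • wsym22 N) (symTablesAn1S2 3 Lc cΛt).vh₂S (symTablesAn1S2 3 Lc cΛt).mixFF j) + fun κ u κ' u' =>
      sgnK (trK (unitS₂ (sfStep Lc j) (smStep 3 Lc j) (T2RecOf 3 Lc (GcombSh Lc) (SpureCombOf (symTablesAn1S2 3 Lc cΛt) ((Lc : ℝ) ^ 4) (-((Lc : ℝ) ^ 8 / 2)) cΛ)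
        (symTablesAn1S2 3 Lc cΛt).M ((Lc : ℝ) ^ 8) cB ((8 * (N : ℝ) ^ 2)⁻¹ • wsym22 N) (symTablesAn1S2 3 Lc cΛt).vh₂S (symTablesAn1S2 3 Lc cΛt).mixFF j) κ u κ' u'))))
      C₂ δ₂)
    (hT₂d : ∀ k j, LocStencil₂ (((1 : ℝ) / 2) • (unitS₂ (sfStep Lc (k + j)) (smStep 3 Lc (k + j))
          (T2RecOf 3 Lc (GcombSh Lc) (SpureCombOf (symTablesAn1S2 3 Lc cΛt) ((Lc : ℝ) ^ 4) (-((Lc : ℝ) ^ 8 / 2)) cΛ) (symTablesAn1S2 3 Lc cΛt).M ((Lc : ℝ) ^ 8) cB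
            ((8 * (N : ℝ) ^ 2)⁻¹ • wsym22 N) (symTablesAn1S2 3 Lc cΛt).vh₂S (symTablesAn1S2 3 Lc cΛt).mixFF (k + j)) + fun κ u κ' u' =>
        sgnK (trK (unitS₂ (sfStep Lc (k + j)) (smStep 3 Lc (k + j)) (T2RecOf 3 Lc (GcombSh Lc) (SpureCombOf (symTablesAn1S2 3 Lc cΛt) ((Lc : ℝ) ^ 4) (-((Lc : ℝ) ^ 8 / 2)) cΛ)
          (symTablesAn1S2 3 Lc cΛt).M ((Lc : ℝ) ^ 8) cB ((8 * (N : ℝ) ^ 2)⁻¹ • wsym22 N) (symTablesAn1S2 3 Lc cΛt).vh₂S (symTablesAn1S2 3 Lc cΛt).mixFF (k + j))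
          κ u κ' u'))) -
      ((1 : ℝ) / 2) • (unitS₂ (sfStep Lc k) (smStep 3 Lc k) (T2RecOf 3 Lc (GcombSh Lc) (SpureCombOf (symTablesAn1S2 3 Lc cΛt) ((Lc : ℝ) ^ 4) (-((Lc : ℝ) ^ 8 / 2)) cΛ)
            (symTablesAn1S2 3 Lc cΛt).M ((Lc : ℝ) ^ 8) cB ((8 * (N : ℝ) ^ 2)⁻¹ • wsym22 N) (symTablesAn1S2 3 Lc cΛt).vh₂S (symTablesAn1S2 3 Lc cΛt).mixFF k) +
        fun κ u κ' u' => sgnK (trK (unitS₂ (sfStep Lc k) (smStep 3 Lc k) (T2RecOf 3 Lc (GcombSh Lc)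
          (SpureCombOf (symTablesAn1S2 3 Lc cΛt) ((Lc : ℝ) ^ 4) (-((Lc : ℝ) ^ 8 / 2)) cΛ) (symTablesAn1S2 3 Lc cΛt).M ((Lc : ℝ) ^ 8) cB ((8 * (N : ℝ) ^ 2)⁻¹ • wsym22 N)
          (symTablesAn1S2 3 Lc cΛt).vh₂S (symTablesAn1S2 3 Lc cΛt).mixFF k) κ u κ' u')))) (c₂ * θ₂ ^ k) δ₂)
    (hδ₂ : 0 < δ₂) (hθ₂0 : 0 ≤ θ₂) (hθ₂1 : θ₂ < 1) (μ ν : Fin 4) :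
    ∃ κ θ : ℝ, 0 ≤ θ ∧ θ < 1 ∧ AllScalesSeq (fun j => B12Beta.secondMoment (TbalOf Lc (JsB12CombShSym hLc N (symTablesAn1S2 3 Lc cΛt) cΛ cB) j) μ ν) κ θ := by
  obtain ⟨⟨Cs', δ₁, hδ₁, hS⟩, ⟨cS', θS', δ₃, -, hθS0, hθS1, hδ₃, hSall⟩⟩ :=
    exists_hS_hSall_ScombOf_of_sectors (symTablesAn1S2 3 Lc cΛt) ((Lc : ℝ) ^ 4) (-((Lc : ℝ) ^ 8 / 2)) cΛ hSl hSb hSld hSbd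
  have hS' : ∀ j, LocStencil (unitS (sfStep Lc j) (smStep 3 Lc j) (ScombOf (symTablesAn1S2 3 Lc cΛt) ((Lc : ℝ) ^ 4) (-((Lc : ℝ) ^ 8 / 2)) cΛ j)) Cs' (min δ₁ δ₃) :=
    fun j => locStencil_mono' (hS j) le_rfl (min_le_left _ _)
  have hSall' : ∀ k j, LocStencil (unitS (sfStep Lc (k + j)) (smStep 3 Lc (k + j)) (ScombOf (symTablesAn1S2 3 Lc cΛt) ((Lc : ℝ) ^ 4) (-((Lc : ℝ) ^ 8 / 2)) cΛ (k + j)) -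
      unitS (sfStep Lc k) (smStep 3 Lc k) (ScombOf (symTablesAn1S2 3 Lc cΛt) ((Lc : ℝ) ^ 4) (-((Lc : ℝ) ^ 8 / 2)) cΛ k)) (cS' * θS' ^ k) (min δ₁ δ₃) :=
    fun k j => locStencil_mono' (hSall k j) le_rfl (min_le_right _ _)
  exact exists_allScalesSeq_JsB12CombShSym_an1_of_sRows_T2ev cΛt hLc hLc2 N cΛ cB hS' hSall' (lt_min hδ₁ hδ₃) hθS0 hθS1 hT₂ hT₂d hδ₂ hθ₂0 hθ₂1 μ ν

/-- [our object; folklore composition] **ROW D1's READING `↔ lim β = stepBal` FOR an1's RECORD ⟸ FOUR SECTOR LETTERS AND TWO T₂ ROWS ONLY** (`CombTowerEndOfT2ev`'s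
`d1Drift_JsB12CombShSym_an1_iff_lim_eq_of_sRows_T2ev` likewise; the VALUE `lim β = stepBal Nc Lc` is row D1's, NOT proved). -/
theorem d1Drift_JsB12CombShSym_an1_iff_lim_eq_of_sectors_T2ev (hLc : Odd Lc) (hLc2 : 2 ≤ Lc) (N : ℕ) (cΛ cB : ℝ)
    (hSl : ∃ Cl δl : ℝ, 0 < δl ∧ ∀ j : ℕ, LocStencil (unitS (sfStep Lc j) (smStep 3 Lc j) (combWilsonAt (d := 3) Lc ((Lc : ℝ) ^ 4) j)) Cl δl)
    (hSb : ∃ Cb δb : ℝ, 0 < δb ∧ ∀ j : ℕ,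
      LocStencil (unitS (sfStep Lc j) (smStep 3 Lc j) (combBornOf Lc (symTablesAn1S2 3 Lc cΛt) ((Lc : ℝ) ^ 4) (-((Lc : ℝ) ^ 8 / 2)) cΛ j)) Cb δb)
    (hSld : ∃ cl θl δl : ℝ, 0 ≤ cl ∧ 0 ≤ θl ∧ θl < 1 ∧ 0 < δl ∧ ∀ k j : ℕ,
      LocStencil (unitS (sfStep Lc (k + j)) (smStep 3 Lc (k + j)) (combWilsonAt (d := 3) Lc ((Lc : ℝ) ^ 4) (k + j))
        - unitS (sfStep Lc k) (smStep 3 Lc k) (combWilsonAt (d := 3) Lc ((Lc : ℝ) ^ 4) k)) (cl * θl ^ k) δl)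
    (hSbd : ∃ cb θb δb : ℝ, 0 ≤ cb ∧ 0 ≤ θb ∧ θb < 1 ∧ 0 < δb ∧ ∀ k j : ℕ,
      LocStencil (unitS (sfStep Lc (k + j)) (smStep 3 Lc (k + j)) (combBornOf Lc (symTablesAn1S2 3 Lc cΛt) ((Lc : ℝ) ^ 4) (-((Lc : ℝ) ^ 8 / 2)) cΛ (k + j))
        - unitS (sfStep Lc k) (smStep 3 Lc k) (combBornOf Lc (symTablesAn1S2 3 Lc cΛt) ((Lc : ℝ) ^ 4) (-((Lc : ℝ) ^ 8 / 2)) cΛ k)) (cb * θb ^ k) δb)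
    (hT₂ : ∀ j, LocStencil₂ (((1 : ℝ) / 2) • (unitS₂ (sfStep Lc j) (smStep 3 Lc j)
        (T2RecOf 3 Lc (GcombSh Lc) (SpureCombOf (symTablesAn1S2 3 Lc cΛt) ((Lc : ℝ) ^ 4) (-((Lc : ℝ) ^ 8 / 2)) cΛ) (symTablesAn1S2 3 Lc cΛt).M ((Lc : ℝ) ^ 8) cB
          ((8 * (N : ℝ) ^ 2)⁻¹ • wsym22 N) (symTablesAn1S2 3 Lc cΛt).vh₂S (symTablesAn1S2 3 Lc cΛt).mixFF j) + fun κ u κ' u' =>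
      sgnK (trK (unitS₂ (sfStep Lc j) (smStep 3 Lc j) (T2RecOf 3 Lc (GcombSh Lc) (SpureCombOf (symTablesAn1S2 3 Lc cΛt) ((Lc : ℝ) ^ 4) (-((Lc : ℝ) ^ 8 / 2)) cΛ)
        (symTablesAn1S2 3 Lc cΛt).M ((Lc : ℝ) ^ 8) cB ((8 * (N : ℝ) ^ 2)⁻¹ • wsym22 N) (symTablesAn1S2 3 Lc cΛt).vh₂S (symTablesAn1S2 3 Lc cΛt).mixFF j) κ u κ' u'))))
      C₂ δ₂)
    (hT₂d : ∀ k j, LocStencil₂ (((1 : ℝ) / 2) • (unitS₂ (sfStep Lc (k + j)) (smStep 3 Lc (k + j))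
          (T2RecOf 3 Lc (GcombSh Lc) (SpureCombOf (symTablesAn1S2 3 Lc cΛt) ((Lc : ℝ) ^ 4) (-((Lc : ℝ) ^ 8 / 2)) cΛ) (symTablesAn1S2 3 Lc cΛt).M ((Lc : ℝ) ^ 8) cB
            ((8 * (N : ℝ) ^ 2)⁻¹ • wsym22 N) (symTablesAn1S2 3 Lc cΛt).vh₂S (symTablesAn1S2 3 Lc cΛt).mixFF (k + j)) + fun κ u κ' u' =>
        sgnK (trK (unitS₂ (sfStep Lc (k + j)) (smStep 3 Lc (k + j)) (T2RecOf 3 Lc (GcombSh Lc) (SpureCombOf (symTablesAn1S2 3 Lc cΛt) ((Lc : ℝ) ^ 4) (-((Lc : ℝ) ^ 8 / 2)) cΛ)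
          (symTablesAn1S2 3 Lc cΛt).M ((Lc : ℝ) ^ 8) cB ((8 * (N : ℝ) ^ 2)⁻¹ • wsym22 N) (symTablesAn1S2 3 Lc cΛt).vh₂S (symTablesAn1S2 3 Lc cΛt).mixFF (k + j))
          κ u κ' u'))) -
      ((1 : ℝ) / 2) • (unitS₂ (sfStep Lc k) (smStep 3 Lc k) (T2RecOf 3 Lc (GcombSh Lc) (SpureCombOf (symTablesAn1S2 3 Lc cΛt) ((Lc : ℝ) ^ 4) (-((Lc : ℝ) ^ 8 / 2)) cΛ)
            (symTablesAn1S2 3 Lc cΛt).M ((Lc : ℝ) ^ 8) cB ((8 * (N : ℝ) ^ 2)⁻¹ • wsym22 N) (symTablesAn1S2 3 Lc cΛt).vh₂S (symTablesAn1S2 3 Lc cΛt).mixFF k) +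
        fun κ u κ' u' => sgnK (trK (unitS₂ (sfStep Lc k) (smStep 3 Lc k) (T2RecOf 3 Lc (GcombSh Lc)
          (SpureCombOf (symTablesAn1S2 3 Lc cΛt) ((Lc : ℝ) ^ 4) (-((Lc : ℝ) ^ 8 / 2)) cΛ) (symTablesAn1S2 3 Lc cΛt).M ((Lc : ℝ) ^ 8) cB ((8 * (N : ℝ) ^ 2)⁻¹ • wsym22 N)
          (symTablesAn1S2 3 Lc cΛt).vh₂S (symTablesAn1S2 3 Lc cΛt).mixFF k) κ u κ' u')))) (c₂ * θ₂ ^ k) δ₂)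
    (hδ₂ : 0 < δ₂) (hθ₂0 : 0 ≤ θ₂) (hθ₂1 : θ₂ < 1) (μ ν : Fin 4) (Nc : ℝ) :
    D1Drift Lc (JsB12CombShSym hLc N (symTablesAn1S2 3 Lc cΛt) cΛ cB) Nc μ ν ↔
      RateCertificate.CauchyRate.lim (fun j => B12Beta.secondMoment (TbalOf Lc (JsB12CombShSym hLc N (symTablesAn1S2 3 Lc cΛt) cΛ cB) j) μ ν) =
        B12Normalization.stepBal Nc Lc := by
  obtain ⟨⟨Cs', δ₁, hδ₁, hS⟩, ⟨cS', θS', δ₃, -, hθS0, hθS1, hδ₃, hSall⟩⟩ :=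
    exists_hS_hSall_ScombOf_of_sectors (symTablesAn1S2 3 Lc cΛt) ((Lc : ℝ) ^ 4) (-((Lc : ℝ) ^ 8 / 2)) cΛ hSl hSb hSld hSbd
  have hS' : ∀ j, LocStencil (unitS (sfStep Lc j) (smStep 3 Lc j) (ScombOf (symTablesAn1S2 3 Lc cΛt) ((Lc : ℝ) ^ 4) (-((Lc : ℝ) ^ 8 / 2)) cΛ j)) Cs' (min δ₁ δ₃) :=
    fun j => locStencil_mono' (hS j) le_rfl (min_le_left _ _)
  have hSall' : ∀ k j, LocStencil (unitS (sfStep Lc (k + j)) (smStep 3 Lc (k + j)) (ScombOf (symTablesAn1S2 3 Lc cΛt) ((Lc : ℝ) ^ 4) (-((Lc : ℝ) ^ 8 / 2)) cΛ (k + j)) -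
      unitS (sfStep Lc k) (smStep 3 Lc k) (ScombOf (symTablesAn1S2 3 Lc cΛt) ((Lc : ℝ) ^ 4) (-((Lc : ℝ) ^ 8 / 2)) cΛ k)) (cS' * θS' ^ k) (min δ₁ δ₃) :=
    fun k j => locStencil_mono' (hSall k j) le_rfl (min_le_right _ _)
  exact d1Drift_JsB12CombShSym_an1_iff_lim_eq_of_sRows_T2ev cΛt hLc hLc2 N cΛ cB hS' hSall' (lt_min hδ₁ hδ₃) hθS0 hθS1 hT₂ hT₂d hδ₂ hθ₂0 hθ₂1 μ ν Nc

/-- [our object; folklore composition] **ROW D1's CESÀRO READING FOR an1's RECORD ⟸ FOUR SECTOR LETTERS AND TWO T₂ ROWS ONLY** (`CombTowerEndOfT2ev`'s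
`d1Drift_JsB12CombShSym_an1_iff_cesaro_of_sRows_T2ev` likewise). -/
theorem d1Drift_JsB12CombShSym_an1_iff_cesaro_of_sectors_T2ev (hLc : Odd Lc) (hLc2 : 2 ≤ Lc) (N : ℕ) (cΛ cB : ℝ)
    (hSl : ∃ Cl δl : ℝ, 0 < δl ∧ ∀ j : ℕ, LocStencil (unitS (sfStep Lc j) (smStep 3 Lc j) (combWilsonAt (d := 3) Lc ((Lc : ℝ) ^ 4) j)) Cl δl)
    (hSb : ∃ Cb δb : ℝ, 0 < δb ∧ ∀ j : ℕ,
      LocStencil (unitS (sfStep Lc j) (smStep 3 Lc j) (combBornOf Lc (symTablesAn1S2 3 Lc cΛt) ((Lc : ℝ) ^ 4) (-((Lc : ℝ) ^ 8 / 2)) cΛ j)) Cb δb)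
    (hSld : ∃ cl θl δl : ℝ, 0 ≤ cl ∧ 0 ≤ θl ∧ θl < 1 ∧ 0 < δl ∧ ∀ k j : ℕ,
      LocStencil (unitS (sfStep Lc (k + j)) (smStep 3 Lc (k + j)) (combWilsonAt (d := 3) Lc ((Lc : ℝ) ^ 4) (k + j))
        - unitS (sfStep Lc k) (smStep 3 Lc k) (combWilsonAt (d := 3) Lc ((Lc : ℝ) ^ 4) k)) (cl * θl ^ k) δl)
    (hSbd : ∃ cb θb δb : ℝ, 0 ≤ cb ∧ 0 ≤ θb ∧ θb < 1 ∧ 0 < δb ∧ ∀ k j : ℕ,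
      LocStencil (unitS (sfStep Lc (k + j)) (smStep 3 Lc (k + j)) (combBornOf Lc (symTablesAn1S2 3 Lc cΛt) ((Lc : ℝ) ^ 4) (-((Lc : ℝ) ^ 8 / 2)) cΛ (k + j))
        - unitS (sfStep Lc k) (smStep 3 Lc k) (combBornOf Lc (symTablesAn1S2 3 Lc cΛt) ((Lc : ℝ) ^ 4) (-((Lc : ℝ) ^ 8 / 2)) cΛ k)) (cb * θb ^ k) δb)
    (hT₂ : ∀ j, LocStencil₂ (((1 : ℝ) / 2) • (unitS₂ (sfStep Lc j) (smStep 3 Lc j)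
        (T2RecOf 3 Lc (GcombSh Lc) (SpureCombOf (symTablesAn1S2 3 Lc cΛt) ((Lc : ℝ) ^ 4) (-((Lc : ℝ) ^ 8 / 2)) cΛ) (symTablesAn1S2 3 Lc cΛt).M ((Lc : ℝ) ^ 8) cB
          ((8 * (N : ℝ) ^ 2)⁻¹ • wsym22 N) (symTablesAn1S2 3 Lc cΛt).vh₂S (symTablesAn1S2 3 Lc cΛt).mixFF j) + fun κ u κ' u' =>
      sgnK (trK (unitS₂ (sfStep Lc j) (smStep 3 Lc j) (T2RecOf 3 Lc (GcombSh Lc) (SpureCombOf (symTablesAn1S2 3 Lc cΛt) ((Lc : ℝ) ^ 4) (-((Lc : ℝ) ^ 8 / 2)) cΛ)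
        (symTablesAn1S2 3 Lc cΛt).M ((Lc : ℝ) ^ 8) cB ((8 * (N : ℝ) ^ 2)⁻¹ • wsym22 N) (symTablesAn1S2 3 Lc cΛt).vh₂S (symTablesAn1S2 3 Lc cΛt).mixFF j) κ u κ' u'))))
      C₂ δ₂)
    (hT₂d : ∀ k j, LocStencil₂ (((1 : ℝ) / 2) • (unitS₂ (sfStep Lc (k + j)) (smStep 3 Lc (k + j))
          (T2RecOf 3 Lc (GcombSh Lc) (SpureCombOf (symTablesAn1S2 3 Lc cΛt) ((Lc : ℝ) ^ 4) (-((Lc : ℝ) ^ 8 / 2)) cΛ) (symTablesAn1S2 3 Lc cΛt).M ((Lc : ℝ) ^ 8) cB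
            ((8 * (N : ℝ) ^ 2)⁻¹ • wsym22 N) (symTablesAn1S2 3 Lc cΛt).vh₂S (symTablesAn1S2 3 Lc cΛt).mixFF (k + j)) + fun κ u κ' u' =>
        sgnK (trK (unitS₂ (sfStep Lc (k + j)) (smStep 3 Lc (k + j)) (T2RecOf 3 Lc (GcombSh Lc) (SpureCombOf (symTablesAn1S2 3 Lc cΛt) ((Lc : ℝ) ^ 4) (-((Lc : ℝ) ^ 8 / 2)) cΛ)
          (symTablesAn1S2 3 Lc cΛt).M ((Lc : ℝ) ^ 8) cB ((8 * (N : ℝ) ^ 2)⁻¹ • wsym22 N) (symTablesAn1S2 3 Lc cΛt).vh₂S (symTablesAn1S2 3 Lc cΛt).mixFF (k + j))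
          κ u κ' u'))) -
      ((1 : ℝ) / 2) • (unitS₂ (sfStep Lc k) (smStep 3 Lc k) (T2RecOf 3 Lc (GcombSh Lc) (SpureCombOf (symTablesAn1S2 3 Lc cΛt) ((Lc : ℝ) ^ 4) (-((Lc : ℝ) ^ 8 / 2)) cΛ)
            (symTablesAn1S2 3 Lc cΛt).M ((Lc : ℝ) ^ 8) cB ((8 * (N : ℝ) ^ 2)⁻¹ • wsym22 N) (symTablesAn1S2 3 Lc cΛt).vh₂S (symTablesAn1S2 3 Lc cΛt).mixFF k) +
        fun κ u κ' u' => sgnK (trK (unitS₂ (sfStep Lc k) (smStep 3 Lc k) (T2RecOf 3 Lc (GcombSh Lc)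
          (SpureCombOf (symTablesAn1S2 3 Lc cΛt) ((Lc : ℝ) ^ 4) (-((Lc : ℝ) ^ 8 / 2)) cΛ) (symTablesAn1S2 3 Lc cΛt).M ((Lc : ℝ) ^ 8) cB ((8 * (N : ℝ) ^ 2)⁻¹ • wsym22 N)
          (symTablesAn1S2 3 Lc cΛt).vh₂S (symTablesAn1S2 3 Lc cΛt).mixFF k) κ u κ' u')))) (c₂ * θ₂ ^ k) δ₂)
    (hδ₂ : 0 < δ₂) (hθ₂0 : 0 ≤ θ₂) (hθ₂1 : θ₂ < 1) (μ ν : Fin 4) (Nc : ℝ) :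
    D1Drift Lc (JsB12CombShSym hLc N (symTablesAn1S2 3 Lc cΛt) cΛ cB) Nc μ ν ↔
      Tendsto (fun m : ℕ => (∑ j ∈ Finset.range m, B12Beta.secondMoment (TbalOf Lc (JsB12CombShSym hLc N (symTablesAn1S2 3 Lc cΛt) cΛ cB) j) μ ν) / (m : ℝ))
        atTop (𝓝 (B12Normalization.stepBal Nc Lc)) := by
  obtain ⟨⟨Cs', δ₁, hδ₁, hS⟩, ⟨cS', θS', δ₃, -, hθS0, hθS1, hδ₃, hSall⟩⟩ :=
    exists_hS_hSall_ScombOf_of_sectors (symTablesAn1S2 3 Lc cΛt) ((Lc : ℝ) ^ 4) (-((Lc : ℝ) ^ 8 / 2)) cΛ hSl hSb hSld hSbd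
  have hS' : ∀ j, LocStencil (unitS (sfStep Lc j) (smStep 3 Lc j) (ScombOf (symTablesAn1S2 3 Lc cΛt) ((Lc : ℝ) ^ 4) (-((Lc : ℝ) ^ 8 / 2)) cΛ j)) Cs' (min δ₁ δ₃) :=
    fun j => locStencil_mono' (hS j) le_rfl (min_le_left _ _)
  have hSall' : ∀ k j, LocStencil (unitS (sfStep Lc (k + j)) (smStep 3 Lc (k + j)) (ScombOf (symTablesAn1S2 3 Lc cΛt) ((Lc : ℝ) ^ 4) (-((Lc : ℝ) ^ 8 / 2)) cΛ (k + j)) -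
      unitS (sfStep Lc k) (smStep 3 Lc k) (ScombOf (symTablesAn1S2 3 Lc cΛt) ((Lc : ℝ) ^ 4) (-((Lc : ℝ) ^ 8 / 2)) cΛ k)) (cS' * θS' ^ k) (min δ₁ δ₃) :=
    fun k j => locStencil_mono' (hSall k j) le_rfl (min_le_right _ _)
  exact d1Drift_JsB12CombShSym_an1_iff_cesaro_of_sRows_T2ev cΛt hLc hLc2 N cΛ cB hS' hSall' (lt_min hδ₁ hδ₃) hθS0 hθS1 hT₂ hT₂d hδ₂ hθ₂0 hθ₂1 μ ν Nc

end Summit.QuantumFields.BalabanUV.Beta.GAN24.CombTowerEndOfSectorsT2ev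

end
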